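import Literature.Computability.Complexity.ToranCounting
import Literature.Computability.Complexity.HashBricks
import Literature.Computability.Complexity.BinarySearchPP
import HarnessLib

/-!
# The witness languages of `PP^{PP^O} ⊆ C·C·P^O` as polynomial-time string predicates (Torán 1991, §4)

Topic `Computability/Complexity` (counting classes), the plumbing half of the proof of Torán's
oracle characterisation `Cₖ₊₁P = PP^{CₖP}` (J. ACM 38 (1991), §4), companion of
`ToranCounting.lean` (the combinatorics) and `CountingHierarchyOracle.lean` (the theorem). For
`L ∈ C·(P^A)` with `A ∈ C·(P^O)` the new witness of `L ∈ C·C·(P^O)` is a majority vote over strings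
`u = d b₁ b₂ · y · as · γ` (guessed answer bits `as` and guessed COUNTS `γ` of the queries of the
`P^A` computation on `w = ⟨x, y⟩`, in the adaptive normal form `AdQuery.adLang Q q D_W A` of
`PRelAdaptiveForm.lean`), whose own witness language `𝒲` must lie in `P^O`. Here `𝒲` is presented
as a ONE-QUERY truth-table reduction (`ttLang`, `TruthTableClosure.lean`) to the `P^O` witness
`D_A` of `A`, with a polynomial-time evaluator `ToranCH.EW`; no closure property of `P^O` beyond
`P^{P^O} = P^O` is then needed. Contents (all string maps assembled from the tree's `FP` bricks —
`pairFn`, `truncSndFn`/`dropSndFn`, `Plumb.takeFn`/`dropFn`/`polyFn`, `HashBricks.umulFn` (block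
offsets `j · Bw` in unary), `Brick.ltFn` (numeral comparison), `EqPair`, `LenLt`, `ballLang`):

* `ToranCH.Data` — the parameters (coin polynomial `p` of `L`, round polynomial `q`, query
  generator `Q` with output bound `s`, evaluator `D_W`; coin polynomial `r` and witness `D_A` of `A`)
  and the derived polynomials `TP` (rounds), `RP`/`BwP` (block width), `NP` (outer coins), `C0P`;
* accessors of the fields of `u` and of the loop/coin strings, the consistency loop
  `ToranCH.ConsV = ballLang TP consBody` ("`as_j` is the threshold bit of `γ_j` at `z_j`"), the
  format test `ToranCH.FmtS` of the inner coins `⟨1ʲ, f · c · 0…0⟩` and the query map `ToranCH.gS`;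
* the evaluator `ToranCH.EW ∈ P` (`EW_mem_P`) and the **reading lemmas** (`mem_ConsV_iff`:
  `ConsV` is `ToranCH.Cons` of `ToranCounting.lean`; `fmtS_and_iff`: format plus a positive answer
  is membership of the coin tail in `ToranCH.S0set`; `mem_EW_iff`).

## References

* J. Torán, *Complexity classes defined by counting quantifiers*, J. ACM 38 (1991) 753–774, §4.
* S. Arora, B. Barak, *Computational Complexity: A Modern Approach*, CUP 2009, §17.2.1, §3.4,
  §1.3 (polynomial-time string manipulation).
-/

namespace Literature.Computability.Complexity

open _root_.Computability Polynomial PRelSigma TTClosure Plumb Brick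

namespace ToranCH

/-! ### The numeral of `2^{r(|z|)}` -/

/-- The transducer replacing every symbol by `0`. [folklore] -/
def zeroT : FST Unit Bool Bool where
  init := ()
  step _ _ := ((), [false])
  front _ := []
  keep _ := true

/-- `zeroT` outputs `0^{|l|}`. [folklore] -/
theorem zeroT_eval (l : List Bool) : zeroT.eval l = List.replicate l.length false := by
  have h : ∀ l : List Bool, (zeroT.run () l).2 = List.replicate l.length false := by
    intro l
    induction l with
    | nil => rfl
    | cons a l ih =>
      rw [FST.run_cons]
      show [false] ++ (zeroT.run () l).2 = _
      rw [ih]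
      rfl
  show [] ++ (if true then (zeroT.run () l).2 else []) = _
  rw [h]
  rfl

/-- **The numeral of `2^{r(|z|)}`**: `pow2NumFn r z = 0^{r|z|} 1` (little-endian), read off the
length of the argument itself (`Meyer.pow2Fn` of `MeyerVerifier.lean` reads it off a nested pair). [folklore] -/
noncomputable def pow2NumFn (r : Polynomial ℕ) : List Bool → List Bool :=
  List.reverse ∘ List.cons true ∘ zeroT.eval ∘ polyFn r

/-- The value of `pow2NumFn`. [folklore] -/
theorem pow2NumFn_apply (r : Polynomial ℕ) (z : List Bool) :
    pow2NumFn r z = List.replicate (r.eval z.length) false ++ [true] := by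
  simp [pow2NumFn, zeroT_eval, polyFn_apply, List.reverse_replicate]

/-- `val (pow2NumFn r z) = 2^{r|z|}`. [folklore] -/
theorem bitsToNat_pow2NumFn (r : Polynomial ℕ) (z : List Bool) : bitsToNat (pow2NumFn r z) = 2 ^ r.eval z.length := by
  rw [pow2NumFn_apply, bitsToNat_append, bitsToNat_replicate_false, List.length_replicate]
  simp

/-- `pow2NumFn r ∈ FP`. [folklore] -/
theorem pow2NumFn_mem_FP (r : Polynomial ℕ) : pow2NumFn r ∈ FP :=
  comp_mem_FP BinSearchPP.reverse_mem_FP (comp_mem_FP (cons_mem_FP true)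
    (comp_mem_FP zeroT.polyTimeComputable_eval (polyFn_mem_FP r)))

/-! ### Parameters and derived polynomials -/

/-- The data of the construction: `L ∈ C·(P^A)` with coin polynomial `p` and witness
`W = adLang Q q DW A` (`Q ∈ FP` with output bound `s`, `DW ∈ P`); `A ∈ C·(P^O)` with coin
polynomial `r` and witness `DA ∈ P^O`. [cite: Toran1991, §4] -/
structure Data where
  /-- coin polynomial of `L` -/
  p : Polynomial ℕ
  /-- round polynomial of the `P^A` computation (in `|w|`) -/
  q : Polynomial ℕ
  /-- coin polynomial of `A` -/
  r : Polynomial ℕ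
  /-- output-length bound of `Q` -/
  s : Polynomial ℕ
  /-- query generator of the `P^A` computation -/
  Q : List Bool → List Bool
  /-- evaluator of the `P^A` computation -/
  DW : Language Bool
  /-- witness language of `A` -/
  DA : Language Bool

namespace Data

variable (P : Data)

/-- `|w| = 2n + 2 + p(n)` for `w = ⟨x, y⟩`. [folklore] -/
noncomputable def ellP : Polynomial ℕ := 2 * X + 2 + P.p
/-- The number of rounds `T = q(|w|)` as a polynomial in `n`. [folklore] -/
noncomputable def TP : Polynomial ℕ := P.q.comp P.ellP
/-- A bound `Z` on the length of every query `Q ⟨w, as ↾ j⟩`, `j ≤ T`. [folklore] -/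
noncomputable def ZP : Polynomial ℕ := P.s.comp (2 * P.ellP + 2 + P.TP)
/-- `R = r(Z)`: the witness counts of the queries are `≤ 2^R`. [folklore] -/
noncomputable def RP : Polynomial ℕ := P.r.comp P.ZP
/-- The block width `Bw = R + 1`. [folklore] -/
noncomputable def BwP : Polynomial ℕ := P.RP + 1
/-- `N = m + (T + T·Bw)`: the outer coin strings are `d b₁ b₂ · y · as · γ`, `N + 3` bits. [folklore] -/
noncomputable def NP : Polynomial ℕ := P.p + (P.TP + P.TP * P.BwP)
/-- `C₀ = 2T + T·Bw + R + 2`: enough inner coins (`ToranCH.cnt_S0set`); the inner vote uses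
`C0P + 1` coins read off the input length. [folklore] -/
noncomputable def C0P : Polynomial ℕ := 2 * P.TP + P.TP * P.BwP + P.RP + 2

/-- `ρ z = r(|z|)`. [folklore] -/
noncomputable def ρ (z : List Bool) : ℕ := P.r.eval z.length
/-- `κ z = #{c ∈ {0,1}^{r|z|} | ⟨z, c⟩ ∈ DA}`. [folklore] -/
noncomputable def κ (z : List Bool) : ℕ := cnt (P.ρ z) {c | boolPair z c ∈ P.DA}

/-- Value of `ellP`. [folklore] -/
theorem eval_ellP (n : ℕ) : P.ellP.eval n = 2 * n + 2 + P.p.eval n := by simp [ellP]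
/-- Value of `TP`. [folklore] -/
theorem eval_TP (n : ℕ) : P.TP.eval n = P.q.eval (2 * n + 2 + P.p.eval n) := by simp [TP, eval_ellP]
/-- Value of `BwP`. [folklore] -/
theorem eval_BwP (n : ℕ) : P.BwP.eval n = P.RP.eval n + 1 := by simp [BwP]
/-- Value of `NP`. [folklore] -/
theorem eval_NP (n : ℕ) : P.NP.eval n = P.p.eval n + (P.TP.eval n + P.TP.eval n * P.BwP.eval n) := by
  simp [NP]
/-- Value of `C0P`. [folklore] -/
theorem eval_C0P (n : ℕ) :
    P.C0P.eval n = 2 * P.TP.eval n + P.TP.eval n * P.BwP.eval n + P.RP.eval n + 2 := by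
  simp [C0P]
/-- Value of `ZP`. [folklore] -/
theorem eval_ZP (n : ℕ) : P.ZP.eval n = P.s.eval (2 * P.ellP.eval n + 2 + P.TP.eval n) := by
  simp [ZP]
/-- Value of `RP`. [folklore] -/
theorem eval_RP (n : ℕ) : P.RP.eval n = P.r.eval (P.ZP.eval n) := by simp [RP]

end Data

/-! ### Accessors -/

section Access

variable (P : Data)

/-- On `b = ⟨x, rest⟩`: `w = ⟨x, rest ↾ m⟩`. [folklore] -/
noncomputable def wB : List Bool → List Bool := truncSndFn P.p
/-- On `b = ⟨x, rest⟩`: `as = (rest ⇂ m) ↾ T`. [folklore] -/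
noncomputable def asB : List Bool → List Bool := sndP ∘ truncSndFn P.TP ∘ dropSndFn P.p
/-- On `b = ⟨x, rest⟩`: `γ = rest ⇂ (m + T)`. [folklore] -/
noncomputable def gaB : List Bool → List Bool := sndP ∘ dropSndFn (P.p + P.TP)
/-- On `b = ⟨x, rest⟩`: `rest ⇂ m = as · γ`. [folklore] -/
noncomputable def tlB : List Bool → List Bool := sndP ∘ dropSndFn P.p
/-- On `b = ⟨x, rest⟩`: the ruler `1^{Bw}`. [folklore] -/
noncomputable def onesBw : List Bool → List Bool := polyFn P.BwP ∘ fstP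
/-- From `v = ⟨x, d b₁ b₂ rest⟩` to `b = ⟨x, rest⟩`. [folklore] -/
noncomputable def bV : List Bool → List Bool := pairFn fstP (List.tail ∘ List.tail ∘ List.tail ∘ sndP)
/-- From `z = ⟨v, ·⟩` to `b`. [folklore] -/
noncomputable def bZ : List Bool → List Bool := bV ∘ fstP

/-- On `z = ⟨v, 1ʲ⟩`: the query `z_j = Q ⟨w, as ↾ j⟩`. [folklore] -/
noncomputable def qryZ : List Bool → List Bool := P.Q ∘ pairFn (wB P ∘ bZ) (takeFn ∘ pairFn sndP (asB P ∘ bZ))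
/-- On `z = ⟨v, 1ʲ⟩`: `as ⇂ j`. [folklore] -/
noncomputable def asjZ : List Bool → List Bool := dropFn ∘ pairFn sndP (asB P ∘ bZ)
/-- On `z = ⟨v, 1ʲ⟩`: the block `γ_j = (γ ⇂ j·Bw) ↾ Bw`. [folklore] -/
noncomputable def blkZ : List Bool → List Bool :=
  takeFn ∘ pairFn (onesBw P ∘ bZ)
    (dropFn ∘ pairFn (HashBricks.umulFn ∘ pairFn sndP (onesBw P ∘ bZ)) (gaB P ∘ bZ))
/-- On `z = ⟨v, 1ʲ⟩`: the threshold bit `[2^{r|z_j|} < 2·val γ_j]`. [folklore] -/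
noncomputable def thrZ : List Bool → List Bool := ltFn ∘ pairFn (pow2NumFn P.r ∘ qryZ P) (List.cons false ∘ blkZ P)

/-- On `z = ⟨v, 1ʲ⟩`: `j < T`. [folklore] -/
noncomputable def GuardZ : Language Bool := pairFn (fstP ∘ bZ) sndP ⁻¹' LenLt P.TP
/-- On `z = ⟨v, 1ʲ⟩`: `as_j = 1`. [folklore] -/
noncomputable def BTZ : Language Bool := asjZ P ⁻¹' HeadIs true
/-- On `z = ⟨v, 1ʲ⟩`: the threshold bit is `1`. [folklore] -/
noncomputable def ThrZ : Language Bool := thrZ P ⁻¹' HeadIs true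
/-- The body of the consistency loop: if `j < T` then `as_j = thr_j`. [cite: Toran1991, §4] -/
noncomputable def consBody : Language Bool := (GuardZ P)ᶜ ⊔ ((BTZ P ⊓ ThrZ P) ⊔ ((BTZ P)ᶜ ⊓ (ThrZ P)ᶜ))
/-- **Consistency** `Cons` on `v`: every guessed bit is the threshold bit of the guessed count. [cite: Toran1991, §4] -/
noncomputable def ConsV : Language Bool := ballLang P.TP (consBody P)
/-- On `v`: the guessed run accepts, `⟨w, as⟩ ∈ DW`. [folklore] -/
noncomputable def OutV : Language Bool := pairFn (wB P ∘ bV) (asB P ∘ bV) ⁻¹' P.DW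
/-- On `v`: `d = 1`. [folklore] -/
noncomputable def DbitV : Language Bool := sndP ⁻¹' HeadIs true
/-- On `v`: `b₁ = 1`. [folklore] -/
noncomputable def B1V : Language Bool := (List.tail ∘ sndP) ⁻¹' HeadIs true
/-- On `v`: `b₂ = 1`. [folklore] -/
noncomputable def B2V : Language Bool := (List.tail ∘ List.tail ∘ sndP) ⁻¹' HeadIs true
/-- On `v`: `as · γ ∈ 0*`. [folklore] -/
noncomputable def ZeroV : Language Bool := (tlB P ∘ bV) ⁻¹' NoBit true

/-- On `z' = ⟨v, e e' c''⟩`: the coin tail `c''`. [folklore] -/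
def c2 : List Bool → List Bool := List.tail ∘ List.tail ∘ sndP
/-- On `z'`: the level part `1ʲ = (c'').1`. [folklore] -/
def jpS : List Bool → List Bool := fstP ∘ c2
/-- On `z'`: `rest'' = (c'').2`. [folklore] -/
def rsS : List Bool → List Bool := sndP ∘ c2
/-- On `z'`: the query `z_j`, `j = |jpS|`. [folklore] -/
noncomputable def qryS : List Bool → List Bool := P.Q ∘ pairFn (wB P ∘ bZ) (takeFn ∘ pairFn (jpS) (asB P ∘ bZ))
/-- On `z'`: `rest'' ⇂ j·Bw`. [folklore] -/
noncomputable def drS : List Bool → List Bool :=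
  dropFn ∘ pairFn (HashBricks.umulFn ∘ pairFn jpS (onesBw P ∘ bZ)) rsS
/-- **The oracle query** on `z'`: `⟨z_j, (rest'' ⇂ j·Bw) ↾ r|z_j|⟩`. [cite: Toran1991, §4] -/
noncomputable def gS : List Bool → List Bool := truncSndFn P.r ∘ pairFn (qryS P) (drS P)
/-- On `z'`: the padding `rest'' ⇂ (j·Bw + r|z_j|)` is zero. [folklore] -/
noncomputable def ZerS : Language Bool := (sndP ∘ dropSndFn P.r ∘ pairFn (qryS P) (drS P)) ⁻¹' NoBit true
/-- On `z'`: `c''` is a well-formed pair code. [folklore] -/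
noncomputable def WfS : Language Bool := fanoutFn c2 (pairFn jpS rsS) ⁻¹' EqPair
/-- On `z'`: the level part is all ones. [folklore] -/
def OnesS : Language Bool := jpS ⁻¹' NoBit false
/-- On `z'`: `j < T`. [folklore] -/
noncomputable def LtS : Language Bool := pairFn (fstP ∘ bZ) jpS ⁻¹' LenLt P.TP
/-- **The format** of the inner coins `c'' = ⟨1ʲ, f · c · 0…0⟩`. [cite: Toran1991, §4] -/
noncomputable def FmtS : Language Bool := WfS ⊓ OnesS ⊓ LtS P ⊓ ZerS P
/-- On `z'`: `e = 1`. [folklore] -/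
noncomputable def ES : Language Bool := sndP ⁻¹' HeadIs true
/-- On `z'`: `c₀ = tail c ∈ 0*`. [folklore] -/
noncomputable def Zc0S : Language Bool := (List.tail ∘ sndP) ⁻¹' NoBit true
/-- On `z'`: `val c₀ < 2·val γ`. [folklore] -/
noncomputable def Lt0S : Language Bool := (ltFn ∘ pairFn (List.tail ∘ sndP) (List.cons false ∘ gaB P ∘ bZ)) ⁻¹' HeadIs true
/-- On `z'`: `val c₀ < 2·val γ + 1`. [folklore] -/
noncomputable def Lt1S : Language Bool := (ltFn ∘ pairFn (List.tail ∘ sndP) (List.cons true ∘ gaB P ∘ bZ)) ⁻¹' HeadIs true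

/-- On `t = ⟨z', bs⟩`: the answer bit is `1`. [folklore] -/
noncomputable def AnsT : Language Bool := sndP ⁻¹' HeadIs true

/-- Pull-back of a `v`-language to `t = ⟨⟨v, c⟩, bs⟩`. [folklore] -/
noncomputable def onV (L : Language Bool) : Language Bool := (fstP ∘ fstP) ⁻¹' L
/-- Pull-back of a `z'`-language to `t = ⟨z', bs⟩`. [folklore] -/
noncomputable def onZ (L : Language Bool) : Language Bool := fstP ⁻¹' L

/-- `Cons ∧ Out` on `t`. [folklore] -/
noncomputable def COt : Language Bool := onV (ConsV P) ⊓ onV (OutV P)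
/-- Branch `d = 0, b₁ = 0`: accept iff (`e = 1` and (`c₀ ∈ 0*` or (format and answer `1`))) or
(`e = 0` and `¬ val c₀ < 2 val γ`). [cite: Toran1991, §4] -/
noncomputable def Br1 : Language Bool :=
  (onZ (ES) ⊓ (onZ (Zc0S) ⊔ (onZ (FmtS P) ⊓ AnsT))) ⊔ ((onZ ES)ᶜ ⊓ (onZ (Lt0S P))ᶜ)
/-- Branch `d = 0, b₁ = 1`: accept iff (`e = 1` and (not format or answer `0`)) or
(`e = 0` and `val c₀ < 2 val γ + 1`). [cite: Toran1991, §4] -/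
noncomputable def Br2 : Language Bool :=
  (onZ ES ⊓ ((onZ (FmtS P))ᶜ ⊔ (AnsT)ᶜ)) ⊔ ((onZ ES)ᶜ ⊓ onZ (Lt1S P))
/-- **The evaluator** of the one-query truth-table reduction defining the witness language `𝒲`.
[cite: Toran1991, §4] -/
noncomputable def EW : Language Bool :=
  (((onV (DbitV))ᶜ ⊓ (onV B1V)ᶜ ⊓ COt P ⊓ Br1 P) ⊔ ((onV DbitV)ᶜ ⊓ onV B1V ⊓ COt P ⊓ Br2 P)) ⊔
    (((onV DbitV)ᶜ ⊓ (COt P)ᶜ ⊓ onV B1V) ⊔ (onV DbitV ⊓ (onV B1V)ᶜ ⊓ ((onV B2V)ᶜ ⊓ onV (ZeroV P))ᶜ))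

end Access

/-! ### Polynomial time -/

section PolyTime

variable {P : Data}

/-- `wB ∈ FP`. [folklore] -/
theorem wB_mem_FP : wB P ∈ FP := truncSndFn_mem_FP _
/-- `asB ∈ FP`. [folklore] -/
theorem asB_mem_FP : asB P ∈ FP :=
  comp_mem_FP sndP_mem_FP (comp_mem_FP (truncSndFn_mem_FP _) (dropSndFn_mem_FP _))
/-- `gaB ∈ FP`. [folklore] -/
theorem gaB_mem_FP : gaB P ∈ FP := comp_mem_FP sndP_mem_FP (dropSndFn_mem_FP _)
/-- `tlB ∈ FP`. [folklore] -/
theorem tlB_mem_FP : tlB P ∈ FP := comp_mem_FP sndP_mem_FP (dropSndFn_mem_FP _)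
/-- `onesBw ∈ FP`. [folklore] -/
theorem onesBw_mem_FP : onesBw P ∈ FP := comp_mem_FP (polyFn_mem_FP _) fstP_mem_FP
/-- `bV ∈ FP`. [folklore] -/
theorem bV_mem_FP : bV ∈ FP :=
  pairFn_mem_FP fstP_mem_FP (comp_mem_FP tail_mem_FP (comp_mem_FP tail_mem_FP (comp_mem_FP tail_mem_FP sndP_mem_FP)))
/-- `bZ ∈ FP`. [folklore] -/
theorem bZ_mem_FP : bZ ∈ FP := comp_mem_FP bV_mem_FP fstP_mem_FP

variable (hQ : P.Q ∈ FP)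
include hQ

/-- `qryZ ∈ FP` for `Q ∈ FP`. [folklore] -/
theorem qryZ_mem_FP : qryZ P ∈ FP :=
  comp_mem_FP hQ (pairFn_mem_FP (comp_mem_FP wB_mem_FP bZ_mem_FP)
    (comp_mem_FP takeFn_mem_FP (pairFn_mem_FP sndP_mem_FP (comp_mem_FP asB_mem_FP bZ_mem_FP))))

omit hQ in
/-- `asjZ ∈ FP`. [folklore] -/
theorem asjZ_mem_FP : asjZ P ∈ FP :=
  comp_mem_FP dropFn_mem_FP (pairFn_mem_FP sndP_mem_FP (comp_mem_FP asB_mem_FP bZ_mem_FP))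

omit hQ in
/-- `blkZ ∈ FP`. [folklore] -/
theorem blkZ_mem_FP : blkZ P ∈ FP :=
  comp_mem_FP takeFn_mem_FP (pairFn_mem_FP (comp_mem_FP onesBw_mem_FP bZ_mem_FP)
    (comp_mem_FP dropFn_mem_FP (pairFn_mem_FP
      (comp_mem_FP HashBricks.umulFn_mem_FP (pairFn_mem_FP sndP_mem_FP (comp_mem_FP onesBw_mem_FP bZ_mem_FP)))
      (comp_mem_FP gaB_mem_FP bZ_mem_FP))))

/-- `thrZ ∈ FP` for `Q ∈ FP`. [folklore] -/
theorem thrZ_mem_FP : thrZ P ∈ FP :=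
  comp_mem_FP ltFn_mem_FP (pairFn_mem_FP (comp_mem_FP (pow2NumFn_mem_FP _) (qryZ_mem_FP hQ))
    (comp_mem_FP (cons_mem_FP false) blkZ_mem_FP))

/-- `consBody ∈ P` for `Q ∈ FP`. [folklore] -/
theorem consBody_mem_P : consBody P ∈ Classes.P := by
  have hG : GuardZ P ∈ Classes.P :=
    preimage_mem_P (LenLt_mem_P _) (pairFn_mem_FP (comp_mem_FP fstP_mem_FP bZ_mem_FP) sndP_mem_FP)
  have hB : BTZ P ∈ Classes.P := preimage_mem_P (HeadIs_mem_P true) asjZ_mem_FP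
  have hT : ThrZ P ∈ Classes.P := preimage_mem_P (HeadIs_mem_P true) (thrZ_mem_FP hQ)
  exact union_mem_P (compl_mem_P_iff.2 hG)
    (union_mem_P (inter_mem_P hB hT) (inter_mem_P (compl_mem_P_iff.2 hB) (compl_mem_P_iff.2 hT)))

/-- `ConsV ∈ P`. [cite: Toran1991, §4] -/
theorem ConsV_mem_P : ConsV P ∈ Classes.P := ballLang_mem_P _ (consBody_mem_P hQ)

omit hQ in
/-- `OutV ∈ P` for `DW ∈ P`. [folklore] -/
theorem OutV_mem_P (hDW : P.DW ∈ Classes.P) : OutV P ∈ Classes.P :=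
  preimage_mem_P hDW (pairFn_mem_FP (comp_mem_FP wB_mem_FP bV_mem_FP) (comp_mem_FP asB_mem_FP bV_mem_FP))

omit hQ in
/-- `c2 ∈ FP`. [folklore] -/
theorem c2_mem_FP : c2 ∈ FP := comp_mem_FP tail_mem_FP (comp_mem_FP tail_mem_FP sndP_mem_FP)
omit hQ in
/-- `jpS ∈ FP`. [folklore] -/
theorem jpS_mem_FP : jpS ∈ FP := comp_mem_FP fstP_mem_FP c2_mem_FP
omit hQ in
/-- `rsS ∈ FP`. [folklore] -/
theorem rsS_mem_FP : rsS ∈ FP := comp_mem_FP sndP_mem_FP c2_mem_FP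

/-- `qryS ∈ FP` for `Q ∈ FP`. [folklore] -/
theorem qryS_mem_FP : qryS P ∈ FP :=
  comp_mem_FP hQ (pairFn_mem_FP (comp_mem_FP wB_mem_FP bZ_mem_FP)
    (comp_mem_FP takeFn_mem_FP (pairFn_mem_FP jpS_mem_FP (comp_mem_FP asB_mem_FP bZ_mem_FP))))

omit hQ in
/-- `drS ∈ FP`. [folklore] -/
theorem drS_mem_FP : drS P ∈ FP :=
  comp_mem_FP dropFn_mem_FP (pairFn_mem_FP
    (comp_mem_FP HashBricks.umulFn_mem_FP (pairFn_mem_FP jpS_mem_FP (comp_mem_FP onesBw_mem_FP bZ_mem_FP))) rsS_mem_FP)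

/-- `gS ∈ FP`. [folklore] -/
theorem gS_mem_FP : gS P ∈ FP :=
  comp_mem_FP (truncSndFn_mem_FP _) (pairFn_mem_FP (qryS_mem_FP hQ) drS_mem_FP)

/-- `FmtS ∈ P`. [folklore] -/
theorem FmtS_mem_P : FmtS P ∈ Classes.P := by
  have hW : WfS ∈ Classes.P := preimage_mem_P EqPair_mem_P (fanoutFn_mem_FP c2_mem_FP (pairFn_mem_FP jpS_mem_FP rsS_mem_FP))
  have hO : OnesS ∈ Classes.P := preimage_mem_P (NoBit_mem_P false) jpS_mem_FP
  have hL : LtS P ∈ Classes.P :=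
    preimage_mem_P (LenLt_mem_P _) (pairFn_mem_FP (comp_mem_FP fstP_mem_FP bZ_mem_FP) jpS_mem_FP)
  have hZ : ZerS P ∈ Classes.P :=
    preimage_mem_P (NoBit_mem_P true) (comp_mem_FP sndP_mem_FP (comp_mem_FP (dropSndFn_mem_FP _)
      (pairFn_mem_FP (qryS_mem_FP hQ) drS_mem_FP)))
  exact inter_mem_P (inter_mem_P (inter_mem_P hW hO) hL) hZ

omit hQ in
/-- The comparison of `c₀` with `b · γ` is in `FP`. [folklore] -/
theorem gaCmp_mem_FP (b : Bool) : (ltFn ∘ pairFn (List.tail ∘ sndP) (List.cons b ∘ gaB P ∘ bZ)) ∈ FP :=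
  comp_mem_FP ltFn_mem_FP (pairFn_mem_FP (comp_mem_FP tail_mem_FP sndP_mem_FP)
    (comp_mem_FP (cons_mem_FP b) (comp_mem_FP gaB_mem_FP bZ_mem_FP)))

omit hQ in
/-- Pull-backs of `P` languages are in `P`. [folklore] -/
private theorem onV_mem_P {L : Language Bool} (hL : L ∈ Classes.P) : onV L ∈ Classes.P :=
  preimage_mem_P hL (comp_mem_FP fstP_mem_FP fstP_mem_FP)

omit hQ in
/-- Pull-backs of `P` languages are in `P`. [folklore] -/
private theorem onZ_mem_P {L : Language Bool} (hL : L ∈ Classes.P) : onZ L ∈ Classes.P :=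
  preimage_mem_P hL fstP_mem_FP

/-- **The evaluator is polynomial-time**: `EW ∈ P` for `Q ∈ FP`, `DW ∈ P`. [cite: Toran1991, §4] -/
theorem EW_mem_P (hDW : P.DW ∈ Classes.P) : EW P ∈ Classes.P := by
  have hD : onV DbitV ∈ Classes.P := onV_mem_P (preimage_mem_P (HeadIs_mem_P true) sndP_mem_FP)
  have hB1 : onV B1V ∈ Classes.P :=
    onV_mem_P (preimage_mem_P (HeadIs_mem_P true) (comp_mem_FP tail_mem_FP sndP_mem_FP))
  have hB2 : onV B2V ∈ Classes.P :=
    onV_mem_P (preimage_mem_P (HeadIs_mem_P true) (comp_mem_FP tail_mem_FP (comp_mem_FP tail_mem_FP sndP_mem_FP)))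
  have hZe : onV (ZeroV P) ∈ Classes.P :=
    onV_mem_P (preimage_mem_P (NoBit_mem_P true) (comp_mem_FP tlB_mem_FP bV_mem_FP))
  have hCO : COt P ∈ Classes.P := inter_mem_P (onV_mem_P (ConsV_mem_P hQ)) (onV_mem_P (OutV_mem_P hDW))
  have hE : onZ ES ∈ Classes.P := onZ_mem_P (preimage_mem_P (HeadIs_mem_P true) sndP_mem_FP)
  have hZc : onZ Zc0S ∈ Classes.P := onZ_mem_P (preimage_mem_P (NoBit_mem_P true) (comp_mem_FP tail_mem_FP sndP_mem_FP))
  have hF : onZ (FmtS P) ∈ Classes.P := onZ_mem_P (FmtS_mem_P hQ)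
  have hA : AnsT ∈ Classes.P := preimage_mem_P (HeadIs_mem_P true) sndP_mem_FP
  have hL0 : onZ (Lt0S P) ∈ Classes.P := onZ_mem_P (preimage_mem_P (HeadIs_mem_P true) (gaCmp_mem_FP false))
  have hL1 : onZ (Lt1S P) ∈ Classes.P := onZ_mem_P (preimage_mem_P (HeadIs_mem_P true) (gaCmp_mem_FP true))
  have hBr1 : Br1 P ∈ Classes.P :=
    union_mem_P (inter_mem_P hE (union_mem_P hZc (inter_mem_P hF hA)))
      (inter_mem_P (compl_mem_P_iff.2 hE) (compl_mem_P_iff.2 hL0))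
  have hBr2 : Br2 P ∈ Classes.P :=
    union_mem_P (inter_mem_P hE (union_mem_P (compl_mem_P_iff.2 hF) (compl_mem_P_iff.2 hA)))
      (inter_mem_P (compl_mem_P_iff.2 hE) hL1)
  refine union_mem_P (union_mem_P ?_ ?_) (union_mem_P ?_ ?_)
  · exact inter_mem_P (inter_mem_P (inter_mem_P (compl_mem_P_iff.2 hD) (compl_mem_P_iff.2 hB1)) hCO) hBr1
  · exact inter_mem_P (inter_mem_P (inter_mem_P (compl_mem_P_iff.2 hD) hB1) hCO) hBr2
  · exact inter_mem_P (inter_mem_P (compl_mem_P_iff.2 hD) (compl_mem_P_iff.2 hCO)) hB1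
  · exact inter_mem_P (inter_mem_P hD (compl_mem_P_iff.2 hB1)) (compl_mem_P_iff.2 (inter_mem_P (compl_mem_P_iff.2 hB2) hZe))

end PolyTime

/-! ### Reading the languages -/

section Reading

variable (P : Data) (x : List Bool) (d b₁ b₂ : Bool) (rest : List Bool)

/-! The components of `u = d b₁ b₂ rest` relative to `x` (`n = |x|`): `m = p n`, `T = TP n`,
`Bw = BwP n`, `w = ⟨x, rest ↾ m⟩`, `as = (rest ⇂ m) ↾ T`, `γ = rest ⇂ (m + T)`. -/
local notation "mm" => Polynomial.eval (List.length x) (Data.p P)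
local notation "TT" => Polynomial.eval (List.length x) (Data.TP P)
local notation "BW" => Polynomial.eval (List.length x) (Data.BwP P)
local notation "ww" => boolPair x (List.take (Polynomial.eval (List.length x) (Data.p P)) rest)
local notation "AS" => List.take (Polynomial.eval (List.length x) (Data.TP P))
  (List.drop (Polynomial.eval (List.length x) (Data.p P)) rest)
local notation "GA" => List.drop (Polynomial.eval (List.length x) (Data.p P) + Polynomial.eval (List.length x) (Data.TP P)) rest
local notation "vv" => boolPair x (d :: b₁ :: b₂ :: rest)

/-- `bV` strips the three leading bits. [folklore] -/
theorem bV_apply : bV vv = boolPair x rest := by simp [bV]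
/-- `wB` reads `w`. [folklore] -/
theorem wB_apply : wB P (boolPair x rest) = ww := by simp [wB, truncSndFn_boolPair]
/-- `asB` reads `as`. [folklore] -/
theorem asB_apply : asB P (boolPair x rest) = AS := by
  simp [asB, truncSndFn_boolPair, dropSndFn_boolPair]
/-- `gaB` reads `γ`. [folklore] -/
theorem gaB_apply : gaB P (boolPair x rest) = GA := by
  simp [gaB, dropSndFn_boolPair]
/-- `tlB` reads `rest ⇂ m`. [folklore] -/
theorem tlB_apply : tlB P (boolPair x rest) = rest.drop mm := by simp [tlB, dropSndFn_boolPair]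
/-- `onesBw` is the ruler `1^{Bw}`. [folklore] -/
theorem onesBw_apply : onesBw P (boolPair x rest) = ones BW := by simp [onesBw]
/-- `bZ` reads `⟨x, rest⟩` off `⟨v, t⟩`. [folklore] -/
theorem bZ_apply (t : List Bool) : bZ (boolPair vv t) = boolPair x rest := by simp [bZ, bV_apply]

variable (j : ℕ)
local notation "zz" => boolPair vv (List.replicate j true)

/-- `qryZ` is the `j`-th query along `as`. [folklore] -/
theorem qryZ_apply : qryZ P zz = qry P.Q ww AS j := by
  simp [qryZ, bZ_apply, wB_apply, asB_apply, qry]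

/-- `asjZ` is `as ⇂ j`. [folklore] -/
theorem asjZ_apply : asjZ P zz = (AS).drop j := by
  simp [asjZ, bZ_apply, asB_apply]

/-- `blkZ` is the `j`-th block of `γ`. [folklore] -/
theorem blkZ_apply : blkZ P zz = blockOf BW GA j := by
  simp [blkZ, bZ_apply, onesBw_apply, gaB_apply, blockOf, HashBricks.umulFn_apply, fstF, sndF]

/-- `thrZ` is the threshold bit `[2^{r|z_j|} < 2 val γ_j]`. [folklore] -/
theorem thrZ_apply : thrZ P zz = [decide (2 ^ P.ρ (qry P.Q ww AS j) < 2 * bitsToNat (blockOf BW GA j))] := by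
  simp [thrZ, qryZ_apply, blkZ_apply, bitsToNat_pow2NumFn, Data.ρ]

/-- Reading `GuardZ`: `j < T`. [folklore] -/
theorem mem_GuardZ_iff : zz ∈ GuardZ P ↔ j < TT := by
  simp [GuardZ, memL_preimage, bZ_apply]

/-- Reading `BTZ`: `as_j = 1`. [folklore] -/
theorem mem_BTZ_iff : zz ∈ BTZ P ↔ ((AS).drop j).head? = some true := by
  rw [BTZ, memL_preimage, asjZ_apply, mem_HeadIs]

/-- Reading `ThrZ`. [folklore] -/
theorem mem_ThrZ_iff : zz ∈ ThrZ P ↔ 2 ^ P.ρ (qry P.Q ww AS j) < 2 * bitsToNat (blockOf BW GA j) := by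
  rw [ThrZ, memL_preimage, thrZ_apply, mem_HeadIs]
  simp

/-- Reading the loop body. [cite: Toran1991, §4] -/
theorem mem_consBody_iff : zz ∈ consBody P ↔
    (j < TT → (((AS).drop j).head? = some true ↔ 2 ^ P.ρ (qry P.Q ww AS j) < 2 * bitsToNat (blockOf BW GA j))) := by
  rw [consBody, PPSharpP.memL_sup, PPSharpP.memL_compl, PPSharpP.memL_sup, ThresholdPP.memL_inf', ThresholdPP.memL_inf', PPSharpP.memL_compl, PPSharpP.memL_compl,
    mem_GuardZ_iff, mem_BTZ_iff, mem_ThrZ_iff]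
  tauto

variable {x d b₁ b₂ rest j}

/-- For a bit string `as` and `j < |as|`: `(as ⇂ j).head? = some true ↔ as_j = true`. [folklore] -/
theorem head?_drop_iff {as : List Bool} {j : ℕ} (hj : j < as.length) :
    (as.drop j).head? = some true ↔ as.getD j false = true := by
  rw [List.head?_drop, List.getD_eq_getElem?_getD, List.getElem?_eq_getElem hj]
  simp

/-- **Reading the consistency loop**: for `|rest| ≥ m + T` (so `|as| = T`), `v ∈ ConsV` iff the
guess `(as, γ)` is consistent in the sense of `ToranCH.Cons`. [cite: Toran1991, §4] -/
theorem mem_ConsV_iff (hrest : mm + TT ≤ rest.length) :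
    vv ∈ ConsV P ↔ Cons P.Q P.ρ ww TT BW AS GA := by
  have hlen : (AS).length = TT := by
    rw [List.length_take, List.length_drop, min_eq_left]; omega
  have hmono : TT ≤ P.TP.eval (vv).length := TM2Iter.eval_mono _ (by rw [length_boolPair]; omega)
  rw [ConsV, mem_ballLang]
  unfold Cons
  constructor
  · intro h j hj
    have hb := (mem_consBody_iff P x d b₁ b₂ rest j).1 (h j (lt_of_lt_of_le hj hmono)) hj
    rw [head?_drop_iff (by rw [hlen]; exact hj)] at hb
    rcases hq : (AS).getD j false with _ | _
    · rw [hq] at hb; symm; simpa using hb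
    · rw [hq] at hb; symm; simpa using hb
  · intro h j _
    rw [mem_consBody_iff]
    intro hj
    rw [head?_drop_iff (by rw [hlen]; exact hj), h j hj]
    simp

/-- Reading `OutV`. [folklore] -/
theorem mem_OutV_iff : vv ∈ OutV P ↔ boolPair ww AS ∈ P.DW := by
  rw [OutV, memL_preimage, pairFn_apply, Function.comp_apply, Function.comp_apply, bV_apply, wB_apply, asB_apply]

/-- Reading the bit `d`. [folklore] -/
theorem mem_DbitV_iff : vv ∈ DbitV ↔ d = true := by simp [DbitV, memL_preimage]
/-- Reading the bit `b₁`. [folklore] -/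
theorem mem_B1V_iff : vv ∈ B1V ↔ b₁ = true := by simp [B1V, memL_preimage]
/-- Reading the bit `b₂`. [folklore] -/
theorem mem_B2V_iff : vv ∈ B2V ↔ b₂ = true := by simp [B2V, memL_preimage]
/-- Reading `ZeroV`: `as · γ ∈ 0*`. [folklore] -/
theorem mem_ZeroV_iff : vv ∈ ZeroV P ↔ true ∉ rest.drop mm := by
  simp [ZeroV, memL_preimage, bV_apply, tlB_apply]

/-! #### The inner coins -/

variable (x d b₁ b₂ rest) (e e' : Bool)

/-- `c2` reads the coin tail `c''`. [folklore] -/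
theorem c2_apply (c'' : List Bool) : c2 (boolPair vv (e :: e' :: c'')) = c'' := by simp [c2]

/-- Reading the coin `e`. [folklore] -/
theorem mem_ES_iff (c'' : List Bool) : boolPair vv (e :: e' :: c'') ∈ ES ↔ e = true := by simp [ES, memL_preimage]
/-- Reading `Zc0S`: `c₀ ∈ 0*`. [folklore] -/
theorem mem_Zc0S_iff (c'' : List Bool) : boolPair vv (e :: e' :: c'') ∈ Zc0S ↔ true ∉ e' :: c'' := by
  simp [Zc0S, memL_preimage]
/-- Reading `Lt0S`: `val c₀ < 2 val γ`. [folklore] -/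
theorem mem_Lt0S_iff (c'' : List Bool) :
    boolPair vv (e :: e' :: c'') ∈ Lt0S P ↔ bitsToNat (e' :: c'') < 2 * bitsToNat GA := by
  simp [Lt0S, memL_preimage, bZ_apply, gaB_apply]
/-- Reading `Lt1S`: `val c₀ < 2 val γ + 1`. [folklore] -/
theorem mem_Lt1S_iff (c'' : List Bool) :
    boolPair vv (e :: e' :: c'') ∈ Lt1S P ↔ bitsToNat (e' :: c'') < 2 * bitsToNat GA + 1 := by
  simp [Lt1S, memL_preimage, bZ_apply, gaB_apply]
  omega

variable (j : ℕ) (rs : List Bool)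

/-! Well-formed inner coins `e e' ⟨1ʲ, rs⟩`. -/
local notation "zw" => boolPair vv (e :: e' :: boolPair (List.replicate j true) rs)

/-- `qryS` on well-formed coins is the `j`-th query. [folklore] -/
theorem qryS_apply : qryS P zw = qry P.Q ww AS j := by
  simp [qryS, jpS, c2_apply, bZ_apply, wB_apply, asB_apply, qry]

/-- `drS` on well-formed coins is `rs ⇂ j·Bw`. [folklore] -/
theorem drS_apply : drS P zw = rs.drop (j * BW) := by
  simp [drS, jpS, rsS, c2_apply, bZ_apply, onesBw_apply, HashBricks.umulFn_apply, fstF, sndF]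

/-- **The oracle query** on well-formed coins: `⟨z_j, (rs ⇂ j·Bw) ↾ r|z_j|⟩`. [cite: Toran1991, §4] -/
theorem gS_apply : gS P zw = boolPair (qry P.Q ww AS j) ((rs.drop (j * BW)).take (P.ρ (qry P.Q ww AS j))) := by
  rw [gS, Function.comp_apply, pairFn_apply, qryS_apply, drS_apply, truncSndFn_boolPair]
  rfl

/-- Reading `ZerS` on well-formed coins. [folklore] -/
theorem mem_ZerS_iff : zw ∈ ZerS P ↔ true ∉ rs.drop (j * BW + P.ρ (qry P.Q ww AS j)) := by
  rw [ZerS, memL_preimage, Function.comp_apply, Function.comp_apply, pairFn_apply, qryS_apply, drS_apply,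
    dropSndFn_boolPair, sndP_boolPair, mem_NoBit, List.drop_drop]
  rfl

/-- Well-formed coins pass `WfS`. [folklore] -/
theorem mem_WfS : zw ∈ WfS := by simp [WfS, memL_preimage, c2_apply, jpS, rsS]

/-- Well-formed coins pass `OnesS`. [folklore] -/
theorem mem_OnesS : zw ∈ OnesS := by simp [OnesS, memL_preimage, jpS, c2_apply]

/-- Reading `LtS` on well-formed coins: `j < T`. [folklore] -/
theorem mem_LtS_iff : zw ∈ LtS P ↔ j < TT := by simp [LtS, memL_preimage, jpS, c2_apply, bZ_apply]

/-- Reading the format on well-formed coins. [cite: Toran1991, §4] -/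
theorem mem_FmtS_iff : zw ∈ FmtS P ↔ j < TT ∧ true ∉ rs.drop (j * BW + P.ρ (qry P.Q ww AS j)) := by
  rw [FmtS, ThresholdPP.memL_inf', ThresholdPP.memL_inf', ThresholdPP.memL_inf', mem_ZerS_iff, mem_LtS_iff]
  have h1 := mem_WfS x d b₁ b₂ rest e e' j rs
  have h2 := mem_OnesS x d b₁ b₂ rest e e' j rs
  constructor
  · rintro ⟨⟨-, hj⟩, hz⟩
    exact ⟨hj, hz⟩
  · rintro ⟨hj, hz⟩
    exact ⟨⟨⟨h1, h2⟩, hj⟩, hz⟩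

variable {e e' j rs}

/-- A string in `WfS ⊓ OnesS` is a well-formed coin string `e e' ⟨1ʲ, rs⟩`. [folklore] -/
theorem exists_of_mem_WfS {c'' : List Bool} (hwf : boolPair vv (e :: e' :: c'') ∈ WfS)
    (hones : boolPair vv (e :: e' :: c'') ∈ OnesS) : ∃ j rs, c'' = boolPair (List.replicate j true) rs := by
  have hwf' : c'' = boolPair (fstP c'') (sndP c'') := by
    simpa [WfS, memL_preimage, c2_apply, jpS, rsS] using hwf
  have h : false ∉ fstP c'' := by simpa [OnesS, memL_preimage, jpS, c2_apply] using hones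
  have hrep : fstP c'' = List.replicate (fstP c'').length true :=
    List.eq_replicate_iff.2 ⟨rfl, fun b hb => by
      cases b
      · exact absurd hb h
      · rfl⟩
  refine ⟨(fstP c'').length, sndP c'', ?_⟩
  rw [← hrep]
  exact hwf'

variable (e e')

/-- **Reading the format and the query.** `z' ∈ FmtS ∧ gS z' ∈ DA` iff the coin tail `c''` lies
in the witness set `S0set` of `ToranCounting.lean` for the levels `ρ_j = r|z_j|` and the witness
sets `D_j = {c | ⟨z_j, c⟩ ∈ DA}` of the queries `z_j` along `as`. [cite: Toran1991, §4] -/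
theorem fmtS_and_iff (c'' : List Bool) :
    (boolPair vv (e :: e' :: c'') ∈ FmtS P ∧ gS P (boolPair vv (e :: e' :: c'')) ∈ P.DA) ↔
      c'' ∈ S0set TT BW (fun j => P.ρ (qry P.Q ww AS j)) (fun j => {c | boolPair (qry P.Q ww AS j) c ∈ P.DA}) := by
  constructor
  · rintro ⟨hF, hg⟩
    have hF' := hF
    rw [FmtS, ThresholdPP.memL_inf', ThresholdPP.memL_inf', ThresholdPP.memL_inf'] at hF'
    obtain ⟨⟨⟨hwf, hones⟩, -⟩, -⟩ := hF'
    obtain ⟨j, rs, rfl⟩ := exists_of_mem_WfS x d b₁ b₂ rest hwf hones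
    rw [mem_FmtS_iff] at hF
    rw [gS_apply] at hg
    refine ⟨j, hF.1, rs, rfl, ?_, ?_⟩
    · beta_reduce
      exact hF.2
    · beta_reduce
      rw [Set.mem_setOf_eq]
      exact hg
  · rintro ⟨j, hj, rs, hc, hzer, hD⟩
    subst hc
    beta_reduce at hzer hD
    rw [Set.mem_setOf_eq] at hD
    rw [mem_FmtS_iff, gS_apply]
    exact ⟨⟨hj, hzer⟩, hD⟩

/-- **Reading the evaluator.** On `t = ⟨⟨v, e e' c''⟩, bs⟩` (with `|rest| ≥ m + T`):
membership in `EW` in terms of the components. [cite: Toran1991, §4] -/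
theorem mem_EW_iff (c'' bs : List Bool) (hrest : mm + TT ≤ rest.length) :
    boolPair (boolPair vv (e :: e' :: c'')) bs ∈ EW P ↔
      ((((d = false ∧ b₁ = false) ∧ (Cons P.Q P.ρ ww TT BW AS GA ∧ boolPair ww AS ∈ P.DW)) ∧
          ((e = true ∧ (true ∉ e' :: c'' ∨ (boolPair vv (e :: e' :: c'') ∈ FmtS P ∧ bs.head? = some true))) ∨
            (e = false ∧ ¬ bitsToNat (e' :: c'') < 2 * bitsToNat GA))) ∨
        (((d = false ∧ b₁ = true) ∧ (Cons P.Q P.ρ ww TT BW AS GA ∧ boolPair ww AS ∈ P.DW)) ∧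
          ((e = true ∧ (boolPair vv (e :: e' :: c'') ∉ FmtS P ∨ bs.head? ≠ some true)) ∨
            (e = false ∧ bitsToNat (e' :: c'') < 2 * bitsToNat GA + 1)))) ∨
      (((d = false ∧ ¬ (Cons P.Q P.ρ ww TT BW AS GA ∧ boolPair ww AS ∈ P.DW)) ∧ b₁ = true) ∨
        ((d = true ∧ b₁ = false) ∧ ¬ (b₂ = false ∧ true ∉ rest.drop mm))) := by
  have hv : ∀ L : Language Bool, boolPair (boolPair vv (e :: e' :: c'')) bs ∈ onV L ↔ vv ∈ L := fun L => by
    simp [onV, memL_preimage]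
  have hz : ∀ L : Language Bool, boolPair (boolPair vv (e :: e' :: c'')) bs ∈ onZ L ↔ boolPair vv (e :: e' :: c'') ∈ L :=
    fun L => by simp [onZ, memL_preimage]
  have hA : boolPair (boolPair vv (e :: e' :: c'')) bs ∈ AnsT ↔ bs.head? = some true := by simp [AnsT, memL_preimage]
  have hCO : boolPair (boolPair vv (e :: e' :: c'')) bs ∈ COt P ↔
      (Cons P.Q P.ρ ww TT BW AS GA ∧ boolPair ww AS ∈ P.DW) := by
    rw [COt, ThresholdPP.memL_inf', hv, hv, mem_ConsV_iff P hrest, mem_OutV_iff]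
  rw [EW, Br1, Br2]
  simp only [PPSharpP.memL_sup, ThresholdPP.memL_inf', PPSharpP.memL_compl, hv, hz, hA, hCO, mem_DbitV_iff, mem_B1V_iff,
    mem_B2V_iff, mem_ZeroV_iff, mem_ES_iff, mem_Zc0S_iff, mem_Lt0S_iff, mem_Lt1S_iff, Bool.not_eq_true]

end Reading

end ToranCH

end Literature.Computability.Complexity
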